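import Mathlib
import Literature.Probability.Percolation.CLE6
import Literature.Probability.Percolation.InterfaceLoopPolygon
import Literature.Probability.Percolation.SitePaths
import Literature.Probability.Percolation.SiteInterfaceReverse
import Literature.Probability.Percolation.SiteInterfaceStructure
import Literature.Probability.LatticeModels.TriangularLatticeProofs
import Summits.CriticalPhenomena.CardyFormulaZ2.Theorems.CardyMagicRigidityLoopLimitZ2EqTSiteEndClusters
import Summits.CriticalPhenomena.CardyFormulaZ2.Theorems.CardyMagicRigidityLoopLimitZ2EqTSiteEndOuterBoundary
import Summits.CriticalPhenomena.CardyFormulaZ2.Theorems.CardyMagicRigidityLoopLimitZ2EqTSiteEndMetric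
import Summits.CriticalPhenomena.CardyFormulaZ2.Theorems.CardyMagicRigidityLoopLimitZ2EqTCFT1Local
import Summits.CriticalPhenomena.CardyFormulaZ2.Theorems.CardyMagicRigidityLoopLimitZ2EqTCFT1Walks
import Summits.CriticalPhenomena.CardyFormulaZ2.Theorems.CardyMagicRigidityLoopLimitZ2EqTCFT1Anchors
import Summits.CriticalPhenomena.CardyFormulaZ2.Theorems.CardyMagicRigidityLoopLimitZ2EqTCFT1
import HarnessLib

/-!
# Stub `stub_cft0` (S2b) of line `Sketch`, crux `LoopLimitZ2EqT` (stmt-CriticalPhenomena-4833):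
# the combinatorial fellow-travelling of the coarse and fine outer boundaries, type `0`

`theorem stub_cft0` — (CFT0), the second hypothesis of `siteEnd_of_cft`
(`…SiteEndMetric.lean`), the type-`0` twin of `stub_cft1` (`…CFT1.lean`): for a type-`0`
(clockwise, closed cluster on the right) interface loop `Γ` of a cell set `τ` and a type-`0`
interface loop `γ` of the blow-up `β τ = {v | (∀ j, 2 ∣ v j) ∨ ⌊v/2⌋ ∈ τ}` whose right (closed)
cluster contains the block centre `2 · rv₀(Γ) + (1,1)`, a rebasing `γ'` of `γ` (same unbased loop
at every mesh) and `Γ` have a monotone unit-step coupling of their face sequences along which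
`dist (2 · hexCenter Γᵢ) (hexCenter γ'ⱼ) ≤ 12`.

Proof. Everything in the fellow-travelling induction of (CFT1) is independent of the type of the
loops: the anchors `ψ i` of the coarse positions (`cft_psi_*`), the forced fine interface steps
between consecutive anchors (`cft_up_chain`, `cft_down_short_chain`, `cft_down_long_chain`) and
the resulting coupling `cft_based` for ANY interface loop of `β τ` based at the anchor `ψ 0`. The
only type-dependent input is the **synchronisation** `cft0_sync` (the twin of `cft_sync`): with
`c⋆` a rightmost cell of the (finite, `siteEnd_finite_cluster_of_shoelace_nonpos`) closed right
cluster of `Γ`, the coarse loop visits the up face `(c⋆, 0)` and the fine loop visits the middle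
face `(2c⋆ + (1,1), 0)` of its blow-up. Both follow from `siteEnd_hexDart_mem_darts` applied to
the REVERSED loops, which are type-`1` interface loops of the complement configurations
(`IsSiteInterfaceLoop.reverse_compl`, `siteEnd_shoelace_reverse_pos`, `lv_reverse`): the left
cluster of `Γ.reverse` in `τᶜ` is the closed cluster of `Γ`, with rightmost cell `c⋆`, so
`hexDart c⋆ 5 ∈ Γ.reverse.darts`; the left cluster of `γ.reverse` in `(β τ)ᶜ` is the closed fine
cluster of `γ`, i.e. the union of the non-corner sites of the blocks of the closed cluster of `Γ`
(`siteEnd_pathIn_compl_blowup_of_pathIn`, `siteEnd_pathIn_of_pathIn_compl_blowup`), whose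
rightmost site is the block centre `ĉ = 2c⋆ + (1,1)` (first coordinate `2c⋆₀ + 1`), so
`hexDart ĉ 5 ∈ γ.reverse.darts`, and the head of that dart is the up face `(ĉ, 0)`, the middle
face of `D(c⋆)`. (No use is made of `β(τᶜ)`, which differs from `(β τ)ᶜ` at the corners.) The
assembly is then verbatim that of `stub_cft1`: rotate `Γ` to start at `(c⋆, 0)`, rebase `γ` at
its anchor, read off from `cft_based` that `γ` visits the anchor `ψ 0` of `Γ`
(`cft_psi_rotateAt`), rebase `γ` there and couple by `cft_based`.
-/

noncomputable section

open Set Metric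

namespace Summit.CriticalPhenomena.CardyFormulaZ2.Cruxes.LoopLimitZ2EqT.HexSegment

open Literature.Probability.Percolation Literature.Probability.LatticeModels
  Literature.Probability.RandomPlanarGeometry

/-! ### The synchronisation point of the coarse and fine outer boundaries, type `0` -/

/-- A closed walk whose reverse contains the hexagon dart `hexDart a 5` visits its head, the up
face `(a, 0)`. -/
theorem cft0_mem_support_of_hexDart_mem_reverse {f : HexVertex} {w : hexGraph.Walk f f} {a : Site 2}
    (h : hexDart a 5 ∈ w.reverse.darts) : ((a, 0) : HexVertex) ∈ w.support := by
  have h1 := w.reverse.dart_snd_mem_support_of_mem_darts h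
  have e : (hexDart a 5).snd = (a, 0) := by
    show hexFace a (5 + 1) = (a, 0)
    rw [show (5 : Fin 6) + 1 = 0 from rfl]
    exact hexFace_zero a
  rw [e, SimpleGraph.Walk.support_reverse, List.mem_reverse] at h1
  exact h1

/-- **Synchronisation of the two outer boundaries, type `0`.** Let `Γ` be a type-`0` interface
loop of `τ` and `γ` a type-`0` interface loop of the blow-up `β τ` whose right (closed) cluster
contains the block centre of `rv₀(Γ)`, and let `c⋆` be a rightmost cell of the (finite) right
cluster of `Γ`. Then `Γ` visits the up face `(c⋆, 0)` — at a positive position — and `γ` visits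
the middle face `(2c⋆ + (1,1), 0)` of its blow-up: the reversed loops are type-`1` interface
loops of `τᶜ` and `(β τ)ᶜ` (`reverse_compl`) whose left clusters are the closed cluster of `Γ` and
its blow-up (the non-corner sites of its blocks), with rightmost sites `c⋆` and `2c⋆ + (1,1)`, so
they cross `hexDart c⋆ 5` and `hexDart (2c⋆ + (1,1)) 5` (`siteEnd_hexDart_mem_darts`), whose
heads are these two up faces. -/
theorem cft0_sync {τ : SiteConfig (Site 2)} {F : HexVertex} {Γ : hexGraph.Walk F F}
    (hΓ : IsSiteInterfaceLoop τ Γ) {f : HexVertex} {γ : hexGraph.Walk f f}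
    (hγ : IsSiteInterfaceLoop {v : Site 2 | (∀ j, (2 : ℤ) ∣ v j) ∨ (fun j => v j / 2) ∈ τ} γ)
    (hΓ0 : shoelace (Γ.support.map hexCenter) ≤ 0) (hγ0 : shoelace (γ.support.map hexCenter) ≤ 0)
    (hp : PathIn triGraph {v : Site 2 | (∀ j, (2 : ℤ) ∣ v j) ∨ (fun j => v j / 2) ∈ τ}ᶜ
      (fun j => 2 * hΓ.rv 0 j + 1) (hγ.rv 0)) :
    ∃ c : Site 2, (∃ k : ℕ, 0 < k ∧ k ≤ Γ.length ∧ Γ.getVert k = (c, 0)) ∧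
      ((fun j => c j + c j + 1 : Site 2), (0 : Fin 2)) ∈ γ.support := by
  set A : Set (Site 2) := {v : Site 2 | (∀ j, (2 : ℤ) ∣ v j) ∨ (fun j => v j / 2) ∈ τ} with hA
  have hlen : 0 < Γ.length := by have := hΓ.isCycle.three_le_length; omega
  have hm : 0 < γ.length := by have := hγ.isCycle.three_le_length; omega
  have hfin := siteEnd_finite_cluster_of_shoelace_nonpos hΓ hΓ0
  obtain ⟨c, hc, hmax⟩ := Set.exists_max_image _ (fun x : Site 2 => x 0) hfin
    ⟨hΓ.rv 0, PathIn.refl (hΓ.rv_not_mem hlen)⟩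
  have hmax' : ∀ x, PathIn triGraph τᶜ (hΓ.rv 0) x → x 0 ≤ c 0 := fun x hx => hmax x hx
  refine ⟨c, ?_, ?_⟩
  · -- the reversed coarse loop, a type-`1` loop of `τᶜ` with left cluster the closed cluster of
    -- `Γ`, crosses `hexDart c 5`, whose head is the up face `(c, 0)`
    have hlv : hΓ.reverse_compl.lv 0 = hΓ.rv (Γ.length - 1 - 0) := hΓ.lv_reverse hlen
    have hrv : PathIn triGraph τᶜ (hΓ.rv 0) (hΓ.rv (Γ.length - 1 - 0)) :=
      siteEnd_pathIn_rv hΓ (by omega)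
    have hd : hexDart c 5 ∈ Γ.reverse.darts :=
      siteEnd_hexDart_mem_darts hΓ.reverse_compl (siteEnd_shoelace_reverse_pos hΓ hΓ0)
        (by rw [hlv]; exact hrv.symm.trans hc) fun x hx => hmax' x (hrv.trans (by rwa [hlv] at hx))
    have hmem := cft0_mem_support_of_hexDart_mem_reverse hd
    obtain ⟨k, hk, hkn⟩ := SimpleGraph.Walk.mem_support_iff_exists_getVert.1 hmem
    rcases Nat.eq_zero_or_pos k with rfl | hk0
    · refine ⟨Γ.length, hlen, le_rfl, ?_⟩
      rw [SimpleGraph.Walk.getVert_length, ← hk, SimpleGraph.Walk.getVert_zero]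
    · exact ⟨k, hk0, hkn, hk⟩
  · -- the reversed fine loop, a type-`1` loop of `(β τ)ᶜ` with left cluster the blow-up of the
    -- closed cluster of `Γ`, crosses `hexDart ĉ 5` at its rightmost site `ĉ = 2c + (1,1)`
    have hlv : hγ.reverse_compl.lv 0 = hγ.rv (γ.length - 1 - 0) := hγ.lv_reverse hm
    have hrv : PathIn triGraph Aᶜ (hγ.rv 0) (hγ.rv (γ.length - 1 - 0)) :=
      siteEnd_pathIn_rv hγ (by omega)
    have hcc : PathIn triGraph Aᶜ (fun j => 2 * hΓ.rv 0 j + 1) (fun j => 2 * c j + 1) :=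
      siteEnd_pathIn_compl_blowup_of_pathIn hc
    have hd : hexDart (fun j => 2 * c j + 1 : Site 2) 5 ∈ γ.reverse.darts := by
      refine siteEnd_hexDart_mem_darts hγ.reverse_compl (siteEnd_shoelace_reverse_pos hγ hγ0)
        (by rw [hlv]; exact hrv.symm.trans (hp.symm.trans hcc)) fun x hx => ?_
      rw [hlv] at hx
      have h1 := siteEnd_pathIn_of_pathIn_compl_blowup (hp.trans (hrv.trans hx))
      rw [siteEnd_half_ctr] at h1
      have h2 : x 0 / 2 ≤ c 0 := hmax' _ h1
      show x 0 ≤ 2 * c 0 + 1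
      omega
    have hmem := cft0_mem_support_of_hexDart_mem_reverse hd
    have e : (fun j => 2 * c j + 1 : Site 2) = fun j => c j + c j + 1 := funext fun j => by ring
    rwa [e] at hmem

/-! ### (CFT0) -/

/-- **(CFT0) The combinatorial fellow-travelling of the coarse and fine outer boundaries, type
`0`** (stub `stub_cft0` of line `Sketch`; the second hypothesis of `siteEnd_of_cft`). For a
type-`0` interface loop `Γ` of a cell set `τ` and a type-`0` interface loop `γ` of the blow-up
`β τ = {v | (∀ j, 2 ∣ v j) ∨ ⌊v/2⌋ ∈ τ}` whose right (closed) cluster contains the block centre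
`2 · rv₀(Γ) + (1,1)`, some rebasing `γ'` of `γ` (the same unbased loop at every mesh) and `Γ`
have monotone unit-step index sequences `i, j` from `(0, 0)` to `(length Γ, length γ')` along
which `dist (2 · hexCenter (Γ.getVert (i k))) (hexCenter (γ'.getVert (j k))) ≤ 12`. -/
theorem stub_cft0 : ∃ C : ℝ, ∀ (τ : SiteConfig (Site 2)) {F : HexVertex} {Γ : hexGraph.Walk F F} (hΓ : IsSiteInterfaceLoop τ Γ) {f : HexVertex} {γ : hexGraph.Walk f f} (hγ : IsSiteInterfaceLoop {v : Site 2 | (∀ j, (2 : ℤ) ∣ v j) ∨ (fun j => v j / 2) ∈ τ} γ), shoelace (Γ.support.map hexCenter) ≤ 0 → shoelace (γ.support.map hexCenter) ≤ 0 → PathIn triGraph {v : Site 2 | (∀ j, (2 : ℤ) ∣ v j) ∨ (fun j => v j / 2) ∈ τ}ᶜ (fun j => 2 * hΓ.rv 0 j + 1) (hγ.rv 0) → ∃ (f' : HexVertex) (γ' : hexGraph.Walk f' f'), (∀ δ : ℝ, UnbasedLoop.mk (BasedLoop.mk (siteLoopCurve δ γ') (isLoop_siteLoopCurve δ γ'))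 = UnbasedLoop.mk (BasedLoop.mk (siteLoopCurve δ γ) (isLoop_siteLoopCurve δ γ))) ∧ ∃ (K : ℕ) (i j : ℕ → ℕ), i 0 = 0 ∧ j 0 = 0 ∧ i K = Γ.length ∧ j K = γ'.length ∧ (∀ k < K, i (k + 1) = i k ∨ i (k + 1) = i k + 1) ∧ (∀ k < K, j (k + 1) = j k ∨ j (k + 1) = j k + 1) ∧ ∀ k ≤ K, dist (2 * hexCenter (Γ.getVert (i k))) (hexCenter (γ'.getVert (j k))) ≤ C := by
  refine ⟨12, fun τ F Γ hΓ f γ hγ hΓ0 hγ0 hp => ?_⟩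
  have hn : 3 ≤ Γ.length := hΓ.isCycle.three_le_length
  -- the anchors of `Γ`
  set ψ : ℕ → HexVertex := fun i => if (Γ.getVert i).2 = 0
    then ((fun j => (Γ.getVert i).1 j + (Γ.getVert i).1 j + 1 : Site 2), (0 : Fin 2))
    else ((fun j => hΓ.rv ((i + Γ.length - 1) % Γ.length) j + (Γ.getVert i).1 j + 1 : Site 2), (0 : Fin 2))
    with hψdef
  have hψ : ∀ i, ψ i = if (Γ.getVert i).2 = 0
      then ((fun j => (Γ.getVert i).1 j + (Γ.getVert i).1 j + 1 : Site 2), (0 : Fin 2))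
      else ((fun j => hΓ.rv ((i + Γ.length - 1) % Γ.length) j + (Γ.getVert i).1 j + 1 : Site 2), (0 : Fin 2)) :=
    fun i => rfl
  -- synchronisation: `Γ` visits `(c, 0)` at a positive position `k`, `γ` visits its anchor
  obtain ⟨c, ⟨k, hk0, hk, hΓk⟩, hmid⟩ := cft0_sync hΓ hγ hΓ0 hγ0 hp
  -- the rotation of `Γ` at `k` and its anchors
  have hΓ₂ := hΓ.rotateAt hk0 hk
  set ψ₂ : ℕ → HexVertex := fun i => if ((Γ.rotateAt k).getVert i).2 = 0
    then ((fun j => ((Γ.rotateAt k).getVert i).1 j + ((Γ.rotateAt k).getVert i).1 j + 1 : Site 2), (0 : Fin 2))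
    else ((fun j => hΓ₂.rv ((i + (Γ.rotateAt k).length - 1) % (Γ.rotateAt k).length) j +
      ((Γ.rotateAt k).getVert i).1 j + 1 : Site 2), (0 : Fin 2)) with hψ₂def
  have hψ₂ : ∀ i, ψ₂ i = if ((Γ.rotateAt k).getVert i).2 = 0
      then ((fun j => ((Γ.rotateAt k).getVert i).1 j + ((Γ.rotateAt k).getVert i).1 j + 1 : Site 2), (0 : Fin 2))
      else ((fun j => hΓ₂.rv ((i + (Γ.rotateAt k).length - 1) % (Γ.rotateAt k).length) j +
        ((Γ.rotateAt k).getVert i).1 j + 1 : Site 2), (0 : Fin 2)) := fun i => rfl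
  have hψ₂0 : ψ₂ 0 = ((fun j => c j + c j + 1 : Site 2), (0 : Fin 2)) := by
    have h0 : ((Γ.rotateAt k).getVert 0).2 = 0 := by rw [SimpleGraph.Walk.getVert_zero, hΓk]
    have h1 : ((Γ.rotateAt k).getVert 0).1 = c := by rw [SimpleGraph.Walk.getVert_zero, hΓk]
    rw [hψ₂, if_pos h0, h1]
  -- `γ` rebased at `ψ₂ 0` passes through every anchor of the rotation, in particular `ψ 0`
  rw [← hψ₂0] at hmid
  obtain ⟨γ₂, hγ₂, -, hsub₂⟩ := cft_exists_rebase hγ hmid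
  have hmem : ψ 0 ∈ γ.support := by
    have h := (cft_based hΓ₂ hψ₂ hγ₂).1 (Γ.length - k) (by rw [SimpleGraph.Walk.length_rotateAt Γ hk]; omega)
    rw [cft_psi_rotateAt hΓ hk0 hk hψ₂ hψ] at h
    exact hsub₂ _ h
  -- rebase `γ` at `ψ 0` and couple
  obtain ⟨γ', hγ', hloop, -⟩ := cft_exists_rebase hγ hmem
  exact ⟨ψ 0, γ', hloop, (cft_based hΓ hψ hγ').2⟩

end Summit.CriticalPhenomena.CardyFormulaZ2.Cruxes.LoopLimitZ2EqT.HexSegment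

end
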